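import Summits.AnomalousDissipation.AnomalousDissipation.Theorems.BaireTransferRobustLoudUpgradeCategorySplit
import Summits.AnomalousDissipation.AnomalousDissipation.Theorems.BaireTransferRobustLoudUpgradeStubDriftStratumClosed
import Summits.AnomalousDissipation.AnomalousDissipation.Theorems.BaireTransferRobustLoudUpgradeStubDriftCorrespondenceUhc
import Summits.AnomalousDissipation.AnomalousDissipation.Theorems.BaireTransferRobustLoudUpgradeStubDriftLscInterior

/-!
# The category of the FULL STEADY LEAF (witnesses of any mean) of the crux `BaireTransfer.RobustLoudUpgrade`
# (stmt-AnomalousDissipation-1144): `F_σ`, meagre residual, generic persistence — only cycles remain outside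

Lead c15 of the line `malkin-cone-group-orbits`, category package, waves 3–4 (assembly of the registered stubs
`stub_driftWeakOfClassical`, `stub_driftLimit`, `stub_driftRegularity`, `stub_driftClassicalOfWeak` — the DRIFTED steady weak
dictionary for classical steady states `u = m + w` of any mean `m` (`νΔw − (w·∇)w − (m·∇)w − ∇p + f = 0`; regularity by Temam's
lattice bootstrap, the drift term being purely imaginary on the diagonal) — and `stub_driftStratumClosed`,
`stub_driftCorrespondenceUhc`, `stub_driftLscInterior`).

* `loudSteadyAll S a E ε` — forces carrying, at some `ν ∈ (0,a)`, a classical steady state of ANY mean with budgets `(E, ε)`;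
  `= loudSteadyLeaf ∪ loudSteadyDrift` (`loudSteadyAll_eq_union`).  It is `F_σ` (`steadyStratumAll`, `isClosed_steadyStratumAll`,
  `loudSteadyAll_eq_iUnion`), hence `isMeagre_loudSteadyAll_diff_interior_loud`: **for every `S, a, E, ε` the steady-loud forces
  (any mean) that are not interior points of `loud S a E ε` form a MEAGRE set** (sharp budgets, no stock); registered sub-goal
  `steadyAll_residual_isMeagre` (level form, leaf written out).
* `driftCorr S n`, `genericSetDrift S` — the drifted steady correspondence (triples `(ν, m, W)`) and the set of forces at which all
  of them are lower hemicontinuous: RESIDUAL by Fort's theorem (`genericSetDrift_mem_residual`), depending on `S` only.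
  **Generic persistence, any mean** (`mem_interior_loud_of_mem_genericSetDrift`, registered def-free form `genericSteadyAll_interior`):
  at every `c ∈ genericSetDrift S`, for all ceilings and budgets, a classical steady witness of any mean with strict budgets makes `c`
  an INTERIOR point of `loud`; `loudSteadyAll S a E ε ∩ genericSetDrift S ⊆ interior (loud S a (2E) (ε/2))` (`0 < ε`).
* `residual_decomposition_steadyAll` — the wild residual of the crux decomposes as
  `loud(E,ε) ∖ cl int loud(2E,ε/2) ⊆ (loudSteadyAll ∩ (genericSetDrift S)ᶜ) ∪ (loudCycle ∖ cl int loud(2E,ε/2))`: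
  **a counterexample to the crux is carried either by a non-generic force (a meagre, budget-free exceptional set) whose loud
  witnesses are steady, or by a genuinely time-periodic witness.**  The category of the cycle piece needs a parabolic compactness
  theorem for `H¹`-bounded periodic classical solutions, not in the tree.

References: Temam, *Navier–Stokes Equations* (1979) Ch. II §1; M. K. Fort, Publ. Math. Debrecen 2 (1951) 100–102; Oxtoby,
*Measure and Category* (1980) Ch. 9; `Cruxes/RobustLoudUpgrade/STRATEGY-CENSUS.md` (W1, D2, R1–R4).
-/

-- `Summit.<Summit>.<Problem>` is the tree's mandated summit-side namespace (CONVENTIONS §2); for this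
-- single-conjunct summit the two coincide, so the duplicate is deliberate.
set_option linter.dupNamespace false

noncomputable section

open scoped Topology ENNReal InnerProductSpace RealInnerProductSpace
open Filter Set Function TopologicalSpace MeasureTheory

namespace Summit.AnomalousDissipation.AnomalousDissipation.Theorems.RobustLoudUpgrade.Category

open Literature.Analysis.FunctionSpaces Literature.Analysis.FunctionSpaces.Torus
open Literature.Analysis.FluidPDE
open Summit.AnomalousDissipation.AnomalousDissipation.Theses.BaireTransfer

/-- The flat unit torus `T³`. -/
local notation "𝕋³" => UnitAddTorus (Fin 3)
/-- Real velocity values. -/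
local notation "ℝ³" => EuclideanSpace ℝ (Fin 3)

/-! ## §1 The full steady-loud set (any mean) and its closed strata -/

/-- The STEADY-LOUD set, witnesses of ANY mean: forces carrying, at some `ν ∈ (0,a)`, a classical steady state of `NS_ν(f_c)` with
`meanEnergy ≤ E`, `meanDissipation ≥ ε`. [folklore] -/
def loudSteadyAll (S : Finset (Fin 3 → ℤ)) (a E ε : ℝ) : Set (Coeff S) :=
  {c | ∃ ν : ℝ, 0 < ν ∧ ν < a ∧ ∃ (u : 𝕋³ → ℝ³) (p : 𝕋³ → ℝ),
    Torus.IsSteadyNSState ν (force S c) u p ∧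
      meanEnergy (fun _ : ℝ => u) ≤ E ∧ ε ≤ meanDissipation ν (fun _ : ℝ => u)}

/-- Its strata: the viscosity confined to the slab `[1/(n+1), a − 1/(n+1)]`. [folklore] -/
def steadyStratumAll (S : Finset (Fin 3 → ℤ)) (a E ε : ℝ) (n : ℕ) : Set (Coeff S) :=
  {c | ∃ ν : ℝ, 1 / ((n : ℝ) + 1) ≤ ν ∧ ν ≤ a - 1 / ((n : ℝ) + 1) ∧ ∃ (u : 𝕋³ → ℝ³) (p : 𝕋³ → ℝ),
    Torus.IsSteadyNSState ν (force S c) u p ∧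
      meanEnergy (fun _ : ℝ => u) ≤ E ∧ ε ≤ meanDissipation ν (fun _ : ℝ => u)}

/-- The steady-loud set splits by the mean of the witness. [folklore] -/
theorem loudSteadyAll_eq_union (S : Finset (Fin 3 → ℤ)) (a E ε : ℝ) :
    loudSteadyAll S a E ε = loudSteadyLeaf S a E ε ∪ loudSteadyDrift S a E ε := by
  ext c
  constructor
  · rintro ⟨ν, hν, hνa, u, p, hst, hE, hε⟩
    by_cases h0 : HasZeroMean u
    · exact Or.inl ⟨ν, hν, hνa, u, p, hst, h0, hE, hε⟩
    · exact Or.inr ⟨ν, hν, hνa, u, p, hst, h0, hE, hε⟩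
  · rintro (⟨ν, hν, hνa, u, p, hst, -, hE, hε⟩ | ⟨ν, hν, hνa, u, p, hst, -, hE, hε⟩)
    · exact ⟨ν, hν, hνa, u, p, hst, hE, hε⟩
    · exact ⟨ν, hν, hνa, u, p, hst, hE, hε⟩

/-- Steady witnesses of any mean are loud witnesses. [folklore] -/
theorem loudSteadyAll_subset_loud (S : Finset (Fin 3 → ℤ)) (a E ε : ℝ) : loudSteadyAll S a E ε ⊆ loud S a E ε := by
  rintro c ⟨ν, hν, hνa, u, p, hst, hE, hε⟩
  exact ⟨ν, hν, hνa, 1, fun _ => u, fun _ => p, one_pos, hst, fun _ => rfl, hE, hε⟩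

/-- The loud set is the steady-loud set (any mean) together with the cycle witnesses. [folklore] -/
theorem loud_eq_loudSteadyAll_union_loudCycle (S : Finset (Fin 3 → ℤ)) (a E ε : ℝ) :
    loud S a E ε = loudSteadyAll S a E ε ∪ loudCycle S a E ε := by
  rw [loud_eq_union, loudSteadyAll_eq_union]

/-- **Each any-mean stratum is closed** (registered stub `stub_driftStratumClosed`). [folklore] -/
theorem isClosed_steadyStratumAll (S : Finset (Fin 3 → ℤ)) (a E ε : ℝ) (n : ℕ) :
    IsClosed (steadyStratumAll S a E ε n) :=
  stub_driftStratumClosed S (1 / ((n : ℝ) + 1)) (a - 1 / ((n : ℝ) + 1)) E ε (by positivity)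

/-- **The steady-loud set (any mean) is `F_σ`.** [folklore] -/
theorem loudSteadyAll_eq_iUnion (S : Finset (Fin 3 → ℤ)) (a E ε : ℝ) :
    loudSteadyAll S a E ε = ⋃ n, steadyStratumAll S a E ε n := by
  ext c
  simp only [loudSteadyAll, steadyStratumAll, mem_setOf_eq, mem_iUnion]
  constructor
  · rintro ⟨ν, hν, hνa, u, p, hst, hE, hε⟩
    obtain ⟨n, hn⟩ := exists_nat_gt (1 / min ν (a - ν))
    have hmin : 0 < min ν (a - ν) := lt_min hν (by linarith)
    have hn1 : 1 / ((n : ℝ) + 1) ≤ min ν (a - ν) := by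
      rw [div_le_iff₀ (by positivity)]
      have h1 : 1 / min ν (a - ν) * min ν (a - ν) = 1 := by field_simp
      nlinarith [hmin, hn, h1]
    refine ⟨n, ν, hn1.trans (min_le_left _ _), ?_, u, p, hst, hE, hε⟩
    have := hn1.trans (min_le_right _ _)
    linarith
  · rintro ⟨n, ν, hν, hνa, u, p, hst, hE, hε⟩
    have hpos : (0 : ℝ) < 1 / ((n : ℝ) + 1) := by positivity
    exact ⟨ν, hpos.trans_le hν, by linarith, u, p, hst, hE, hε⟩

/-! ## §2 The steady leaf (any mean) of the upgrade fails at most on a meagre set -/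

/-- The non-interior part of `loudSteadyAll` is meagre. [folklore] -/
theorem isMeagre_loudSteadyAll_diff_interior (S : Finset (Fin 3 → ℤ)) (a E ε : ℝ) :
    IsMeagre (loudSteadyAll S a E ε \ interior (loudSteadyAll S a E ε)) := by
  rw [loudSteadyAll_eq_iUnion]
  exact stub_fsigma_meagre (steadyStratumAll S a E ε) (isClosed_steadyStratumAll S a E ε)

/-- **THE STEADY LEAF OF THE UPGRADE — WITNESSES OF ANY MEAN — FAILS AT MOST ON A MEAGRE SET**: for every `S, a, E, ε` the
steady-loud forces that are not INTERIOR points of `loud S a E ε` (same budgets, no stock) form a meagre subset of `P_S`. [folklore] -/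
theorem isMeagre_loudSteadyAll_diff_interior_loud (S : Finset (Fin 3 → ℤ)) (a E ε : ℝ) :
    IsMeagre (loudSteadyAll S a E ε \ interior (loud S a E ε)) :=
  (isMeagre_loudSteadyAll_diff_interior S a E ε).mono fun _ hx =>
    (show _ ∈ _ \ _ from ⟨hx.1, fun h => hx.2 (interior_mono (loudSteadyAll_subset_loud S a E ε) h)⟩)

/-- Corollary in the crux's shape (`0 ≤ E`, `0 ≤ ε`): the steady leaf of the wild residual is meagre. [folklore] -/
theorem isMeagre_steadyAll_residual (S : Finset (Fin 3 → ℤ)) (a E ε : ℝ) (hE : 0 ≤ E) (hε : 0 ≤ ε) :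
    IsMeagre (loudSteadyAll S a E ε \ closure (interior (loud S a (2 * E) (ε / 2)))) := by
  refine (isMeagre_loudSteadyAll_diff_interior_loud S a E ε).mono fun _ hx =>
    (show _ ∈ _ \ _ from ⟨hx.1, fun h => hx.2 ?_⟩)
  exact (interior_mono (loud_mono (by linarith) (by linarith))).trans subset_closure h

/-- A classical steady witness (any mean) with POSITIVE dissipation has positive energy (through the drifted weak dictionary:
`meanDissipation = (W, f) ≤ ‖W‖·‖f‖₂`, `meanEnergy = ‖m‖² + ‖W‖²`). [folklore] -/
theorem meanEnergy_pos_of_meanDissipation_pos_all {S : Finset (Fin 3 → ℤ)} {c : Coeff S} {ν : ℝ} (hν : 0 < ν)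
    {u : 𝕋³ → ℝ³} {p : 𝕋³ → ℝ} (hst : Torus.IsSteadyNSState ν (force S c) u p)
    (hD : 0 < meanDissipation ν (fun _ : ℝ => u)) : 0 < meanEnergy (fun _ : ℝ => u) := by
  obtain ⟨W, -, -, hEq, -, hDq⟩ := stub_driftWeakOfClassical ν (force S c) u p hν (CensusInterior.isSmooth_force c) hst
  rw [hEq]
  rw [hDq] at hD
  have hcs : Torus.pairing W.1 (force S c) ≤ ‖W‖ * ‖(CensusInterior.memLp_force c).toLp (force S c)‖ :=
    (le_abs_self _).trans (Torus.abs_pairing_coe_le (CensusInterior.memLp_force c) W)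
  have hW : 0 < ‖W‖ := by
    by_contra h
    have h' : ‖W‖ = 0 := le_antisymm (not_lt.1 h) (norm_nonneg _)
    rw [h', zero_mul] at hcs
    linarith
  positivity

/-- The level form, any mean, with the leaf written out at level `j`: for EVERY `S` (no stock), all budgets with `0 < ε` and every
level, the steady part of `LOUD_j(S,E,ε) ∖ closure (interior LOUD_j(S,2E,ε/2))` is meagre. [folklore] -/
theorem isMeagre_steadyAll_residual_level (S : Finset (Fin 3 → ℤ)) (E ε : ℝ) (hε : 0 < ε) (j : ℕ) :
    IsMeagre (loudSteadyAll S (1 / ((j : ℝ) + 1)) E ε \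
      closure (interior (loud S (1 / ((j : ℝ) + 1)) (2 * E) (ε / 2)))) := by
  rcases le_or_gt 0 E with hE | hE
  · exact isMeagre_steadyAll_residual S _ E ε hE hε.le
  · have hempty : loudSteadyAll S (1 / ((j : ℝ) + 1)) E ε = ∅ := by
      ext c
      simp only [mem_empty_iff_false, iff_false]
      rintro ⟨ν, hν, -, u, p, hst, hEu, hDu⟩
      have h0 := meanEnergy_pos_of_meanDissipation_pos_all hν hst (hε.trans_le hDu)
      linarith
    rw [hempty, empty_sdiff]
    exact IsMeagre.empty

/-- **Registered sub-goal `steadyAll_residual_isMeagre` (lead c15, wave 4 assembly)** — the steady leaf of the crux's wild residual,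
witnesses of ANY mean, is MEAGRE: for every `S` (no stock), all budgets with `0 < ε` and every level `j`. [folklore] -/
theorem steadyAll_residual_isMeagre : ∀ (S : Finset (Fin 3 → ℤ)) (E ε : ℝ), 0 < ε → ∀ j : ℕ,
    IsMeagre ({c : Coeff S | ∃ ν : ℝ, 0 < ν ∧ ν < 1 / ((j : ℝ) + 1) ∧
      ∃ (u : UnitAddTorus (Fin 3) → EuclideanSpace ℝ (Fin 3)) (p : UnitAddTorus (Fin 3) → ℝ),
        Torus.IsSteadyNSState ν (force S c) u p ∧
          meanEnergy (fun _ : ℝ => u) ≤ E ∧ ε ≤ meanDissipation ν (fun _ : ℝ => u)} \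
      closure (interior (loud S (1 / ((j : ℝ) + 1)) (2 * E) (ε / 2)))) :=
  fun S E ε hε j => isMeagre_steadyAll_residual_level S E ε hε j

/-! ## §3 Generic persistence for steady witnesses of any mean -/

/-- The DRIFTED steady correspondence of the stratum `n`: triples `(ν, m, W)` of a viscosity `ν ∈ [1/(n+1), n]`, a drift `‖m‖ ≤ n`
and a state `W ∈ H` with `‖∇W‖² ≤ n²` satisfying the drifted steady weak identity for `f_c`. [folklore] -/
def driftCorr (S : Finset (Fin 3 → ℤ)) (n : ℕ) (c : Coeff S) : Set (ℝ × ℝ³ × energySpace (Fin 3)) :=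
  {q : ℝ × EuclideanSpace ℝ (Fin 3) × energySpace (Fin 3) | 1 / ((n : ℝ) + 1) ≤ q.1 ∧ q.1 ≤ (n : ℝ) ∧ ‖q.2.1‖ ≤ (n : ℝ) ∧
    eGradNormSq (q.2.2.1 : UnitAddTorus (Fin 3) → EuclideanSpace ℝ (Fin 3)) ≤ ENNReal.ofReal ((n : ℝ) ^ 2) ∧
    ∀ w : UnitAddTorus (Fin 3) → EuclideanSpace ℝ (Fin 3), IsSmooth w → IsDivFree w → HasZeroMean w →
      Torus.nsGeneratorPairing q.1 (force S c) q.2.2 w +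
        ∫ x, ⟪Torus.fderiv w x q.2.1, (q.2.2.1 : UnitAddTorus (Fin 3) → EuclideanSpace ℝ (Fin 3)) x⟫_ℝ = 0}

/-- **The generic set for steady witnesses of any mean**: forces at which every drifted steady correspondence is lower
hemicontinuous.  Depends on `S` only. [folklore] -/
def genericSetDrift (S : Finset (Fin 3 → ℤ)) : Set (Coeff S) :=
  ⋂ n : ℕ, {c | LowerHemicontinuousAt (driftCorr S n) c}

/-- The drifted correspondence is upper hemicontinuous (registered stub `stub_driftCorrespondenceUhc`). [folklore] -/
theorem upperHemicontinuous_driftCorr (S : Finset (Fin 3 → ℤ)) (n : ℕ) : UpperHemicontinuous (driftCorr S n) :=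
  stub_driftCorrespondenceUhc S n

/-- **`genericSetDrift S` is RESIDUAL** (Fort's theorem per stratum; `ℝ × ℝ³ × H` is second countable and regular).
[cite: Fort1951, Thm 2] -/
theorem genericSetDrift_mem_residual (S : Finset (Fin 3 → ℤ)) : genericSetDrift S ∈ residual (Coeff S) := by
  haveI : Fact ((2 : ℝ≥0∞) ≠ ∞) := ⟨ENNReal.ofNat_ne_top⟩
  refine (countable_iInter_mem (ι := ℕ)).2 fun n => ?_
  have h : IsMeagre {c : Coeff S | ¬ LowerHemicontinuousAt (driftCorr S n) c} :=
    stub_fort (driftCorr S n) (upperHemicontinuous_driftCorr S n)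
  have hc : {c : Coeff S | ¬ LowerHemicontinuousAt (driftCorr S n) c}ᶜ = {c | LowerHemicontinuousAt (driftCorr S n) c} := by
    ext; simp
  rw [← hc]
  exact h

/-- `genericSetDrift S` is dense. [folklore] -/
theorem dense_genericSetDrift (S : Finset (Fin 3 → ℤ)) : Dense (genericSetDrift S) :=
  dense_of_mem_residual (genericSetDrift_mem_residual S)

/-- Its complement is meagre. [folklore] -/
theorem isMeagre_compl_genericSetDrift (S : Finset (Fin 3 → ℤ)) : IsMeagre (genericSetDrift S)ᶜ := by
  rw [IsMeagre, compl_compl]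
  exact genericSetDrift_mem_residual S

/-- **GENERIC PERSISTENCE, witnesses of any mean.**  At every `c ∈ genericSetDrift S`, for ALL ceilings and budgets: a classical
steady witness of ANY mean of `NS_ν(f_c)` at some `ν ∈ (0,a)` with strict budgets makes `c` an INTERIOR point of `loud S a E ε`
(registered stub `stub_driftLscInterior` on a stratum containing the witness). [folklore] -/
theorem mem_interior_loud_of_mem_genericSetDrift {S : Finset (Fin 3 → ℤ)} {c : Coeff S} (hc : c ∈ genericSetDrift S)
    {a E ε ν : ℝ} (hν : 0 < ν) (hνa : ν < a) {u : 𝕋³ → ℝ³} {p : 𝕋³ → ℝ} (hst : Torus.IsSteadyNSState ν (force S c) u p)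
    (hE : meanEnergy (fun _ : ℝ => u) < E) (hD : ε < meanDissipation ν (fun _ : ℝ => u)) :
    c ∈ interior (loud S a E ε) := by
  obtain ⟨n, hn⟩ := exists_nat_ge (max (max (1 / ν) ν) (max (max (gradNormSq u) ‖∫ y, u y‖) 1))
  have h1 : 1 / ν ≤ n := (le_max_left _ _).trans ((le_max_left _ _).trans hn)
  have h2 : ν ≤ n := (le_max_right _ _).trans ((le_max_left _ _).trans hn)
  have h3 : gradNormSq u ≤ n := (le_max_left _ _).trans ((le_max_left _ _).trans ((le_max_right _ _).trans hn))
  have h3m : ‖∫ y, u y‖ ≤ n := (le_max_right _ _).trans ((le_max_left _ _).trans ((le_max_right _ _).trans hn))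
  have h4 : (1 : ℝ) ≤ n := (le_max_right _ _).trans ((le_max_right _ _).trans hn)
  have h1' : 1 / ((n : ℝ) + 1) ≤ ν := by
    rw [div_le_iff₀ (by positivity)]
    have : 1 ≤ ν * n := by rwa [div_le_iff₀' hν] at h1
    nlinarith
  have h3' : gradNormSq u ≤ (n : ℝ) ^ 2 := h3.trans (by nlinarith)
  exact stub_driftLscInterior S n a E ε c (mem_iInter.1 hc n) ⟨ν, hν, hνa, h1', h2, u, p, hst, h3m, h3', hE, hD⟩

/-- **Registered sub-goal `genericSteadyAll_interior` (lead c15, wave 4 assembly)** — def-free existential form: for every `S` there is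
a RESIDUAL set `G ⊆ P_S` such that for all ceilings and budgets, every `c ∈ G` carrying a classical steady state of ANY mean at some
`ν ∈ (0,a)` with `meanEnergy < E` and `meanDissipation > ε` is an INTERIOR point of `loud S a E ε`. [folklore] -/
theorem genericSteadyAll_interior : ∀ (S : Finset (Fin 3 → ℤ)), ∃ G : Set (Coeff S), G ∈ residual (Coeff S) ∧
    ∀ (a E ε : ℝ) (c : Coeff S), c ∈ G → ∀ (ν : ℝ), 0 < ν → ν < a →
      ∀ (u : UnitAddTorus (Fin 3) → EuclideanSpace ℝ (Fin 3)) (p : UnitAddTorus (Fin 3) → ℝ),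
        Torus.IsSteadyNSState ν (force S c) u p → meanEnergy (fun _ : ℝ => u) < E →
          ε < meanDissipation ν (fun _ : ℝ => u) → c ∈ interior (loud S a E ε) :=
  fun S => ⟨genericSetDrift S, genericSetDrift_mem_residual S, fun _ _ _ _ hc _ hν hνa _ _ hst hE hD =>
    mem_interior_loud_of_mem_genericSetDrift hc hν hνa hst hE hD⟩

/-- **The crux's shape on the generic set, witnesses of any mean** (`0 < ε`; no stock; uniform in budgets and ceiling). [folklore] -/
theorem loudSteadyAll_inter_genericSetDrift_subset (S : Finset (Fin 3 → ℤ)) (a E ε : ℝ) (hε : 0 < ε) :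
    loudSteadyAll S a E ε ∩ genericSetDrift S ⊆ interior (loud S a (2 * E) (ε / 2)) := by
  rintro c ⟨⟨ν, hν, hνa, u, p, hst, hEu, hDu⟩, hc⟩
  have hEpos : 0 < E := (meanEnergy_pos_of_meanDissipation_pos_all hν hst (hε.trans_le hDu)).trans_le hEu
  exact mem_interior_loud_of_mem_genericSetDrift hc hν hνa hst (by linarith) (by linarith)

/-! ## §4 The wild residual, decomposed: non-generic steady ∪ cycle -/

/-- **Decomposition of the wild residual (final form of this seat).**  For `0 < ε`, a loud force outside `closure (interior LOUD₂)`
either carries a classical STEADY loud witness (any mean) and is NON-GENERIC — it lies in the meagre, budget-free set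
`(genericSetDrift S)ᶜ` — or it carries a loud classical time-periodic solution that is not constant in time. [folklore] -/
theorem residual_decomposition_steadyAll (S : Finset (Fin 3 → ℤ)) (a E ε : ℝ) (hε : 0 < ε) :
    loud S a E ε \ closure (interior (loud S a (2 * E) (ε / 2))) ⊆
      (loudSteadyAll S a E ε ∩ (genericSetDrift S)ᶜ) ∪ (loudCycle S a E ε \ closure (interior (loud S a (2 * E) (ε / 2)))) := by
  rintro c ⟨hc, hn⟩
  rw [loud_eq_loudSteadyAll_union_loudCycle] at hc
  rcases hc with hs | hy
  · refine Or.inl ⟨hs, fun hg => hn (subset_closure ?_)⟩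
    exact loudSteadyAll_inter_genericSetDrift_subset S a E ε hε ⟨hs, hg⟩
  · exact Or.inr ⟨hy, hn⟩

/-- The steady piece of the decomposition is MEAGRE, for all budgets at once. [folklore] -/
theorem isMeagre_loudSteadyAll_inter_compl_genericSetDrift (S : Finset (Fin 3 → ℤ)) (a E ε : ℝ) :
    IsMeagre (loudSteadyAll S a E ε ∩ (genericSetDrift S)ᶜ) :=
  (isMeagre_compl_genericSetDrift S).mono inter_subset_right

end Summit.AnomalousDissipation.AnomalousDissipation.Theorems.RobustLoudUpgrade.Category

end
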